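import Summits.AtomisticToContinuum.FouriersLaw.Theses.CoercivePulse
import Summits.AtomisticToContinuum.FouriersLaw.Theorems.HeatVarianceCalculus.Negative.LoadBearing
import Literature.MathematicalPhysics.KineticTheory.InfiniteChainObservables
import Literature.MathematicalPhysics.KineticTheory.InfiniteChainGibbsExistenceShift

/-!
# `PulseCalculus` / Negative: the carrier clause of `PreservesMeasure` is load-bearing

Support file (`--supports stmt-AtomisticToContinuum-15385`) of the disprover seat of the crux
`CoercivePulse.PulseCalculus` (route CoercivePulse of `AtomisticToContinuum/FouriersLaw`). The crux is NOT
refuted (it reduces to the proved sibling `CageBudgetFekete.HeatVarianceCalculus` plus the pulse regularity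
and the local Helfand identity of line `Sketch`); what is landed here is the LOAD-BEARING ANALYSIS of its
guard on the dynamics, in the PULSE form (the sibling file
`Theorems/HeatVarianceCalculus/Negative/LoadBearing.lean` does this for the current-only crux):

* `exists_pseudoDynamics_pulse` — for every shift-invariant DLR state `μ` of `pinnedChain ω₂ lam β γ`
  (`ω₂, lam, β > 0`) at `T > 0` there is an inhabitant `D` of `InfiniteChainDynamics (pinnedChain …)`
  (empty carrier, `φ₀ = id`, `φ_t = R` for `t ≠ 0`) all of whose maps PRESERVE `μ` and commute with the
  shift EVERYWHERE, whose two-time products with ANY momentum-even site functional `h` are static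
  (`∫(h₀-c)(h_x∘φ_t-c)dμ = ∫(h₀-c)(h_x-c)dμ`: the pulse `S(x,t) = S(x,0)`, the Helfand moment is constant)
  while `C(t) = -C₀` for `t ≠ 0`, `C₀ = ∑_x ∫ j_0 j_x dμ > 0`;
* `pulseCalculus_false_without_carrierAE` — hence the crux with `D.PreservesMeasure μ` weakened to its
  second clause `∀ t, MeasurePreserving (D.flow t) μ μ` is FALSE: its Laplace-form Helfand identity
  (conjunct 5) at `ν = 1` would read `-C₀ = ½∫₀^∞e^{-t}·0 = 0`. Any proof must use `∀ᵐ σ ∂μ, σ ∈ D.carrier`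
  (the line does, once, through the canonical-twin rigidity). Note the pseudo-dynamics PASSES conjuncts (3)
  and (4) (static clustering, constant `M`): only the identity detects the non-Hamiltonian flow;
* `pulseCalculus_false_without_preservesMeasure` — a fortiori with the hypothesis dropped.

No new definitions. cdisprove seat refuter-cdisprove-stmt-AtomisticToContinuum-15385-0, 2026-08-17.
-/

noncomputable section

namespace Summit.AtomisticToContinuum.FouriersLaw.Theorems.PulseCalculus.Negative

open MeasureTheory Filter Topology Set
open Literature.MathematicalPhysics.KineticTheory.HeatConduction
open Summit.AtomisticToContinuum.FouriersLaw.Theorems.HeatVarianceCalculus.Negative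
  (static_sum_pos map_momentumReversalZ_eq)

/-! ## §1 The carrier-free pseudo-dynamics, pulse form -/

/-- **A measure-preserving, shift-commuting inhabitant of `InfiniteChainDynamics` with a STATIC pulse
and an odd-jump current correlation.** For every shift-invariant DLR state `μ` of `pinnedChain ω₂ lam β γ`
(`ω₂, lam, β > 0`) at `T > 0` there is `D` with: every `φ_t` preserves `μ`; `φ_t ∘ shift = shift ∘ φ_t`
everywhere; for every site functional `h` even under momentum reversal and all `c, x, t`,
`∫ (h σ 0 - c)(h (φ_t σ) x - c) dμ = ∫ (h σ 0 - c)(h σ x - c) dμ`; and `C(t) = -C₀` for `t ≠ 0` with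
`0 < C₀ = ∑_x ∫ j_0 j_x dμ`. The inhabitant: `carrier = ∅` (so `mapsTo`, `flow_zero`, `isSolution`,
`unique` hold vacuously), `φ₀ = id`, `φ_t = R` for `t ≠ 0` — it violates exactly the clause
`∀ᵐ σ ∂μ, σ ∈ D.carrier` of `PreservesMeasure`. [folklore] -/
theorem exists_pseudoDynamics_pulse {ω₂ lam β : ℝ} (γ : ℝ) (hω : 0 < ω₂) (hl : 0 < lam) (hβ : 0 < β)
    {T : ℝ} (hT : 0 < T) {μ : Measure ChainConfig}
    (hμ : (pinnedChain ω₂ lam β γ).IsChainGibbsMeasure T μ) (hS : IsShiftInvariant μ) :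
    ∃ D : InfiniteChainDynamics (pinnedChain ω₂ lam β γ),
      (∀ t : ℝ, MeasurePreserving (D.flow t) μ μ) ∧
      (∀ (t : ℝ) (σ : ChainConfig), D.flow t (shift σ) = shift (D.flow t σ)) ∧
      (∀ h : ChainConfig → ℤ → ℝ, (∀ σ x, h (momentumReversalZ σ) x = h σ x) →
        ∀ (c : ℝ) (x : ℤ) (t : ℝ),
          ∫ σ, (h σ 0 - c) * (h (D.flow t σ) x - c) ∂μ = ∫ σ, (h σ 0 - c) * (h σ x - c) ∂μ) ∧
      (∀ t : ℝ, t ≠ 0 → D.currentCorrelation μ t =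
        -∑' x : ℤ, ∫ σ, (pinnedChain ω₂ lam β γ).bondCurrentZ σ 0 *
          (pinnedChain ω₂ lam β γ).bondCurrentZ σ x ∂μ) ∧
      0 < ∑' x : ℤ, ∫ σ, (pinnedChain ω₂ lam β γ).bondCurrentZ σ 0 *
          (pinnedChain ω₂ lam β γ).bondCurrentZ σ x ∂μ := by
  set P := pinnedChain ω₂ lam β γ with hP
  have hR : μ.map momentumReversalZ = μ := map_momentumReversalZ_eq γ hω hl.le hβ.le hT hμ hS
  have hpos := static_sum_pos γ hω hl hβ hT hμ hS
  -- the pseudo-dynamics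
  set D : InfiniteChainDynamics P :=
    { carrier := ∅
      flow := fun t σ => if t = 0 then σ else momentumReversalZ σ
      mapsTo := fun _ σ h => absurd h (Set.notMem_empty σ)
      flow_zero := fun σ h => absurd h (Set.notMem_empty σ)
      isSolution := fun σ h => absurd h (Set.notMem_empty σ)
      unique := fun _ hγ _ t => absurd (hγ t) (Set.notMem_empty _) } with hD
  have hflow0 : D.flow 0 = id := by funext σ; simp [hD]
  have hflowt : ∀ t : ℝ, t ≠ 0 → D.flow t = momentumReversalZ := fun t ht => by
    funext σ; simp [hD, ht]
  refine ⟨D, fun t => ?_, fun t σ => ?_, fun h hh c x t => ?_, fun t ht => ?_, hpos⟩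
  · by_cases ht : t = 0
    · subst ht; rw [hflow0]; exact MeasurePreserving.id μ
    · rw [hflowt t ht]; exact ⟨momentumReversalZ.measurable, hR⟩
  · by_cases ht : t = 0
    · subst ht; simp [hflow0]
    · simp only [hflowt t ht]; exact (shift_momentumReversalZ σ).symm
  · by_cases ht : t = 0
    · subst ht; simp [hflow0]
    · rw [hflowt t ht]; simp only [hh]
  · simp only [InfiniteChainDynamics.currentCorrelation, hflowt t ht, bondCurrentZ_momentumReversalZ,
      mul_neg, integral_neg, tsum_neg]

/-! ## §2 Load-bearing analysis of `D.PreservesMeasure μ` for the pulse crux -/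

/-- **The carrier clause `∀ᵐ σ ∂μ, σ ∈ D.carrier` is load-bearing for `PulseCalculus`.** The crux with
`D.PreservesMeasure μ` (= `(∀ᵐ σ ∂μ, σ ∈ D.carrier) ∧ ∀ t, MeasurePreserving (D.flow t) μ μ`) WEAKENED
to its second clause (everything else verbatim) is false. Witness: `ω₂ = lam = β = T = 1`, `γ = 0`, the
shift-invariant DLR state (`R`-invariant by `map_momentumReversalZ_eq`) and the pseudo-dynamics of
`exists_pseudoDynamics_pulse`: its pulse is static, so the right-hand side of the Laplace-form Helfand
identity vanishes, while the left-hand side at `ν = 1` is `∫₀^∞ e^{-t}(-C₀)dt = -C₀ < 0`. [folklore] -/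
theorem pulseCalculus_false_without_carrierAE :
    ¬ ∀ ω₂ lam β γ : ℝ, 0 < ω₂ → 0 < lam → 0 < β → ∀ T : ℝ, 0 < T → ∀ μ : Measure ChainConfig,
      (pinnedChain ω₂ lam β γ).IsChainGibbsMeasure T μ → IsShiftInvariant μ →
      μ.map (fun σ : ChainConfig => fun x : ℤ => ((σ x).1, -(σ x).2)) = μ →
      ∀ D : InfiniteChainDynamics (pinnedChain ω₂ lam β γ),
        (∀ t : ℝ, MeasurePreserving (D.flow t) μ μ) →
        (∀ t : ℝ, ∀ᵐ σ ∂μ, D.flow t (shift σ) = shift (D.flow t σ)) →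
        ∀ h : ChainConfig → ℤ → ℝ,
          h = (fun (σ : ChainConfig) (x : ℤ) => (σ x).2 ^ 2 / 2 + (pinnedChain ω₂ lam β γ).U (σ x).1 +
            ((pinnedChain ω₂ lam β γ).V ((σ (x + 1)).1 - (σ x).1) +
              (pinnedChain ω₂ lam β γ).V ((σ x).1 - (σ (x - 1)).1)) / 2) →
        ∀ S : ℤ → ℝ → ℝ,
          S = (fun (x : ℤ) (t : ℝ) =>
            ∫ σ, (h σ 0 - ∫ σ', h σ' 0 ∂μ) * (h (D.flow t σ) x - ∫ σ', h σ' 0 ∂μ) ∂μ) →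
        (∀ t : ℝ, D.HasAbsConvergentCorrelation μ t) ∧
        (∀ ν : ℝ, 0 < ν → IntegrableOn
          (fun t : ℝ => Real.exp (-(ν * t)) * D.currentCorrelation μ t) (Set.Ioi 0)) ∧
        (∀ t : ℝ, Summable (fun x : ℤ => (1 + (x : ℝ) ^ 2) * |S x t|)) ∧
        Continuous (fun t : ℝ => ∑' x : ℤ, (x : ℝ) ^ 2 * S x t) ∧
        (∀ ν : ℝ, 0 < ν →
          IntegrableOn (fun t : ℝ => Real.exp (-(ν * t)) *
            ((∑' x : ℤ, (x : ℝ) ^ 2 * S x t) - (∑' x : ℤ, (x : ℝ) ^ 2 * S x 0))) (Set.Ioi 0) ∧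
          ∫ t in Set.Ioi (0:ℝ), Real.exp (-(ν * t)) * D.currentCorrelation μ t =
            ν ^ 2 / 2 * ∫ t in Set.Ioi (0:ℝ), Real.exp (-(ν * t)) *
              ((∑' x : ℤ, (x : ℝ) ^ 2 * S x t) - (∑' x : ℤ, (x : ℝ) ^ 2 * S x 0))) := by
  intro h
  obtain ⟨μ, hμ, hS, -⟩ :=
    OscillatorChain.exists_isChainGibbsMeasure_shiftInvariant_superstable_pinnedChain
      (ω₂ := 1) (lam := 1) (β := 1) (0 : ℝ) one_pos zero_le_one zero_le_one (T := 1) one_pos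
  have hR' : μ.map (fun σ : ChainConfig => fun x : ℤ => ((σ x).1, -(σ x).2)) = μ :=
    map_momentumReversalZ_eq 0 one_pos zero_le_one zero_le_one one_pos hμ hS
  set P := pinnedChain 1 1 1 0 with hP
  obtain ⟨D, hmp, hsh, hstat, hCt, hpos⟩ :=
    exists_pseudoDynamics_pulse (ω₂ := 1) (lam := 1) (β := 1) 0 one_pos one_pos one_pos one_pos hμ hS
  set C₀ := ∑' x : ℤ, ∫ σ, P.bondCurrentZ σ 0 * P.bondCurrentZ σ x ∂μ with hC₀
  -- the site energy and the pulse of the pseudo-dynamics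
  set hE : ChainConfig → ℤ → ℝ := fun (σ : ChainConfig) (x : ℤ) => (σ x).2 ^ 2 / 2 + P.U (σ x).1 +
      (P.V ((σ (x + 1)).1 - (σ x).1) + P.V ((σ x).1 - (σ (x - 1)).1)) / 2 with hEdef
  set S : ℤ → ℝ → ℝ := fun (x : ℤ) (t : ℝ) =>
      ∫ σ, (hE σ 0 - ∫ σ', hE σ' 0 ∂μ) * (hE (D.flow t σ) x - ∫ σ', hE σ' 0 ∂μ) ∂μ with hSdef
  obtain ⟨-, -, -, -, h5⟩ := h 1 1 1 0 one_pos one_pos one_pos 1 one_pos μ hμ hS hR' D hmp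
    (fun t => Eventually.of_forall (hsh t)) hE hEdef S hSdef
  obtain ⟨-, hEq⟩ := h5 1 one_pos
  -- the pulse is static: `S x t = S x 0`
  have hEven : ∀ σ x, hE (momentumReversalZ σ) x = hE σ x := fun σ x => by
    simp only [hEdef, momentumReversalZ_apply, even_two.neg_pow]
  have hSt : ∀ (x : ℤ) (t : ℝ),
      S x t = ∫ σ, (hE σ 0 - ∫ σ', hE σ' 0 ∂μ) * (hE σ x - ∫ σ', hE σ' 0 ∂μ) ∂μ :=
    fun x t => hstat hE hEven _ x t
  have hdiff : ∀ t : ℝ, (∑' x : ℤ, (x : ℝ) ^ 2 * S x t) - (∑' x : ℤ, (x : ℝ) ^ 2 * S x 0) = 0 := by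
    intro t; simp only [hSt, sub_self]
  simp only [hdiff, mul_zero, integral_zero] at hEq
  -- the left-hand side is `-C₀`
  have hL : ∫ t in Set.Ioi (0:ℝ), Real.exp (-(1 * t)) * D.currentCorrelation μ t = -C₀ := by
    have he : EqOn (fun t : ℝ => Real.exp (-(1 * t)) * D.currentCorrelation μ t)
        (fun t : ℝ => Real.exp (-t) * (-C₀)) (Set.Ioi 0) := by
      intro t ht
      simp only [one_mul, hCt t (ne_of_gt (Set.mem_Ioi.mp ht)), hC₀]
    rw [setIntegral_congr_fun measurableSet_Ioi he, integral_mul_const, integral_exp_neg_Ioi_zero,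
      one_mul]
  rw [hL] at hEq
  linarith

/-- **A fortiori: `D.PreservesMeasure μ` cannot be dropped from `PulseCalculus`.** [folklore] -/
theorem pulseCalculus_false_without_preservesMeasure :
    ¬ ∀ ω₂ lam β γ : ℝ, 0 < ω₂ → 0 < lam → 0 < β → ∀ T : ℝ, 0 < T → ∀ μ : Measure ChainConfig,
      (pinnedChain ω₂ lam β γ).IsChainGibbsMeasure T μ → IsShiftInvariant μ →
      μ.map (fun σ : ChainConfig => fun x : ℤ => ((σ x).1, -(σ x).2)) = μ →
      ∀ D : InfiniteChainDynamics (pinnedChain ω₂ lam β γ),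
        (∀ t : ℝ, ∀ᵐ σ ∂μ, D.flow t (shift σ) = shift (D.flow t σ)) →
        ∀ h : ChainConfig → ℤ → ℝ,
          h = (fun (σ : ChainConfig) (x : ℤ) => (σ x).2 ^ 2 / 2 + (pinnedChain ω₂ lam β γ).U (σ x).1 +
            ((pinnedChain ω₂ lam β γ).V ((σ (x + 1)).1 - (σ x).1) +
              (pinnedChain ω₂ lam β γ).V ((σ x).1 - (σ (x - 1)).1)) / 2) →
        ∀ S : ℤ → ℝ → ℝ,
          S = (fun (x : ℤ) (t : ℝ) =>
            ∫ σ, (h σ 0 - ∫ σ', h σ' 0 ∂μ) * (h (D.flow t σ) x - ∫ σ', h σ' 0 ∂μ) ∂μ) →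
        (∀ t : ℝ, D.HasAbsConvergentCorrelation μ t) ∧
        (∀ ν : ℝ, 0 < ν → IntegrableOn
          (fun t : ℝ => Real.exp (-(ν * t)) * D.currentCorrelation μ t) (Set.Ioi 0)) ∧
        (∀ t : ℝ, Summable (fun x : ℤ => (1 + (x : ℝ) ^ 2) * |S x t|)) ∧
        Continuous (fun t : ℝ => ∑' x : ℤ, (x : ℝ) ^ 2 * S x t) ∧
        (∀ ν : ℝ, 0 < ν →
          IntegrableOn (fun t : ℝ => Real.exp (-(ν * t)) *
            ((∑' x : ℤ, (x : ℝ) ^ 2 * S x t) - (∑' x : ℤ, (x : ℝ) ^ 2 * S x 0))) (Set.Ioi 0) ∧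
          ∫ t in Set.Ioi (0:ℝ), Real.exp (-(ν * t)) * D.currentCorrelation μ t =
            ν ^ 2 / 2 * ∫ t in Set.Ioi (0:ℝ), Real.exp (-(ν * t)) *
              ((∑' x : ℤ, (x : ℝ) ^ 2 * S x t) - (∑' x : ℤ, (x : ℝ) ^ 2 * S x 0))) :=
  fun h => pulseCalculus_false_without_carrierAE
    fun ω₂ lam β γ hω hl hβ T hT μ hμ hS hR D _ hsh => h ω₂ lam β γ hω hl hβ T hT μ hμ hS hR D hsh

end Summit.AtomisticToContinuum.FouriersLaw.Theorems.PulseCalculus.Negative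

end
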